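import Literature.NumberTheory.EllipticCurves.ThreeIsogenySelmerRankOneProportionProofs
import Literature.NumberTheory.EllipticCurves.ThreeIsogenySelmerRatioOneEverywhereProofs
import HarnessLib

/-!
# Bhargava–Klagsbrun–Lemke Oliver–Shnidman 2019, Theorem 2.4 on a signed class `T_m(φ)` — the §9.1
# average-rank bound `|m| + 3^{−|m|}` replayed in the kernel

Cross-ladder literature-typing layer (cell `bsd-littype`, seat 08, gen 8). Theorems only (no
definitions, no named facts). Source: Bhargava–Klagsbrun–Lemke Oliver–Shnidman, Duke Math. J.
**168** (2019) = arXiv:1709.09790 (REFEREED; held text `paper:arxiv-1709.09790`), §9.1 "Proof of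
Theorem (avgrank)" (chunk p0014 L31–L41), with the convexity inequality of Bhargava–Elkies–Shnidman,
J. Lond. Math. Soc. **101** (2020), display (8.2).

BKLOS §9.1 (p0014 L33–L41): "For each `m ∈ ℤ`, we define `T_m(φ) = {s ∈ F^*/F^{*2} : c(φ_s) = 3^m}`.
From the proof of Theorem (main), we see that `T_m` is either empty or cut out by finitely many local
conditions. Moreover, the average size of `Sel_φ(E_s)` for `s ∈ T_m` is `1 + 3^m`. Cassels' formula
[…] shows that `c(φ)c(φ̂) = 1`. Thus the average size of `Sel_{φ̂}(E'_s)` for `s ∈ T_m` is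
`1 + 3^{−m}`. […] a convexity bound shows that the average rank of `Sel_φ(E_s) ⊕ Sel_{φ̂}(E'_s)` for
`s ∈ T_m` is at most `|m| + 3^{−|m|}`. Since this rank is an upper bound on the rank of `Sel₃(E_s)`,
which is itself an upper bound on the rank of `E_s(F)`, the theorem follows for any `Σ` contained in
`T_m`. The general case follows by writing `Σ = ⋃_m (Σ ∩ T_m)` and adding together the rank bounds
on each `Σ ∩ T_m` weighted by their density."

This file replays the sentence "the theorem follows for any `Σ` contained in `T_m`" in the kernel,
for every `m ∈ ℤ`, from three of the four REFEREED named facts of `IsogenySelmerGroups.lean` /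
`IsogenySelmerGroupsComposite.lean` (`thm21_averageCard_selmerGroup`, `casselsFormula_selmerRatio`,
`lemma91_selmerGroup_exact`; no parity input is needed for Theorem 2.4): pointwise, off the finitely
many classes carrying rational `3`-torsion on `E_s` or `E'_s` (Mazur–Rubin 2010, L.5.5), Cassels'
formula with trivial torsion terms reads `r_φ = r_{φ̂} + m` exactly
(`natLog_card_selmerGroup_three_le_min_sub_one_add_natAbs_of_facts`:
`r₃ ≤ r_φ + r_{φ̂} ≤ min(#Sel_φ, #Sel_{φ̂}) − 1 + |m|`, BES (8.2)); Thm. 2.1 for `φ̂` (if `m ≥ 0`) or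
`φ` (if `m < 0`) gives the average `1 + 3^{−|m|}` of that `min`; the finitely many exceptional
classes do not affect a `limsup` of averages over an INFINITE family
(`squareClassAverageLe_of_le_off_finite`). The "general case" sentence (the weighted union over
`m`) needs the two §9.1 framework claims recorded in `OPEN-QUESTIONS-08.md` §K (BKLOS-Q6: densities
of local-condition sets; `T_m` cut out by finitely many local conditions) and is NOT replayed.

Hypotheses kept explicit (printed claims not typed as facts, as in the companion files): the signed
class `Σ ⊆ T_m(φ)` is cut out by finitely many local conditions (p0014 L33–L34) and is INFINITE
(in print: non-empty, hence of positive density by §8 — the density statement is framework claim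
(F1); `SquareClassProportionGe.infinite_setOf` turns any positive lower proportion into
infinitude). The signed class is read with the representative convention of `twistSelmerCard`
(sign of `t(φ_s)` at `s = Quotient.out t`).

## Main statements

* `BhargavaKlagsbrunLemkeOliverShnidman2019.squareClassAverageLe_selmerRankThree_signedClass_of_facts`:
  granted Thm. 2.1, Cassels' formula and Lemma 9.1, for a `3`-isogeny dual pair `(φ, φ̂)` over a
  number field (models with `a₁ = a₃ = 0`), `m : ℤ`, and an infinite `Σ ⊆ T_m(φ)` cut out by
  finitely many local conditions: the average over `Σ` of the `3`-Selmer rank `log₃ #Sel^{(3)}(E_s)`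
  is at most `|m| + 3^{−|m|}`.
* `…squareClassAverageLe_rank_signedClass_of_facts`: the same for `rk E_s(F)` — **Theorem 2.4 for
  `Σ ⊆ T_m(φ)`** ("the theorem follows for any `Σ` contained in `T_m`"), i.e. the conclusion of the
  binder `thm24_averageRank_le` on such `Σ` (where `rankBoundSummand φ ≡ |m| + 3^{−|m|}`).

## References

* [BhargavaKlagsbrunLemkeOliverShnidman2019] Duke Math. J. 168 (2019), §9.1 (chunk p0014 L31–L41),
  Thm. 2.4 (chunk p0005 L1–L2).
* [BhargavaElkiesShnidman2019] J. Lond. Math. Soc. (2) 101 (2020), Thm. 43 with display (8.2)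
  (chunk p0017 L26–L37).
* [MazurRubin2010] Invent. Math. 181 (2010), Lemma 5.5.
-/

noncomputable section

open scoped Classical NumberField
open Filter Topology
open WeierstrassCurve IsDedekindDomain NumberField

universe u

namespace Literature.NumberTheory.EllipticCurves

/-! ## §1 Averages over an infinite family: finitely many classes do not matter -/

section Averages

variable {K : Type u} [Field K] [NumberField K]

/-- The finite averages of BKLOS §2 of a function constant on `Σ` tend to that constant (once `Σ(X)`
is non-empty). [cite: BhargavaKlagsbrunLemkeOliverShnidman2019, §2 (chunk p0004 L25–L31, avg_Σ and Σ(X))] -/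
theorem tendsto_squareClassAverage_of_eq_const {S : Set (SquareClass K)} (hS : S.Nonempty)
    {F : SquareClass K → ℝ} {c : ℝ} (hF : ∀ t ∈ S, F t = c) :
    Tendsto (squareClassAverage S F) atTop (𝓝 c) := by
  refine (tendsto_congr' ((eventually_nonempty_sep_height_lt hS).mono fun X hX ↦ ?_)).mpr
    tendsto_const_nhds
  rw [show squareClassAverage S F X = squareClassAverage S (fun _ ↦ c) X from
    le_antisymm (squareClassAverage_mono (fun t ht ↦ (hF t ht).le) X)
      (squareClassAverage_mono (fun t ht ↦ (hF t ht).ge) X),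
    squareClassAverage_const c hX]

/-- `|Σ(X)| → ∞` for an INFINITE family `Σ` of square classes (each `Σ(X)` is finite, and any
`N` members of `Σ` have height `< X` for `X` large).
[cite: BhargavaKlagsbrunLemkeOliverShnidman2019, §2 (chunk p0004 L30, Σ(X) = {s ∈ Σ : H(s) < X})] -/
theorem tendsto_natCard_sep_height_lt_atTop_of_infinite {S : Set (SquareClass K)}
    (hS : S.Infinite) :
    Tendsto (fun X : ℕ ↦ (Nat.card {t : SquareClass K | t ∈ S ∧ squareClassHeight t < X} : ℝ))
      atTop atTop := by
  refine tendsto_natCast_atTop_atTop.comp (tendsto_atTop_atTop.mpr fun N ↦ ?_)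
  obtain ⟨T, hTS, hTcard⟩ := hS.exists_subset_card_eq N
  refine ⟨T.sup squareClassHeight + 1, fun X hX ↦ ?_⟩
  have hA : {t : SquareClass K | t ∈ S ∧ squareClassHeight t < X}.Finite :=
    (finite_setOf_squareClassHeight_lt X).subset fun t ht ↦ ht.2
  have hsub : (T : Set (SquareClass K)) ⊆ {t : SquareClass K | t ∈ S ∧ squareClassHeight t < X} :=
    fun t ht ↦ ⟨hTS ht, Nat.lt_of_lt_of_le (Nat.lt_succ_of_le (Finset.le_sup ht)) hX⟩
  calc N = T.card := hTcard.symm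
    _ = (T : Set (SquareClass K)).ncard := (Set.ncard_coe_finset T).symm
    _ ≤ {t : SquareClass K | t ∈ S ∧ squareClassHeight t < X}.ncard := Set.ncard_le_ncard hsub hA
    _ = Nat.card {t : SquareClass K | t ∈ S ∧ squareClassHeight t < X} :=
        (Nat.card_coe_set_eq _).symm

/-- The average over `Σ(X)` of a non-negative function supported on a finite set `G` is at most
`(∑_{t ∈ G} f t) / |Σ(X)|`. [cite: BhargavaKlagsbrunLemkeOliverShnidman2019, §2 (chunk p0004 L25–L31, avg_Σ)] -/
theorem squareClassAverage_indicator_le {S G : Set (SquareClass K)} (hG : G.Finite)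
    {f : SquareClass K → ℝ} (hf : ∀ t, 0 ≤ f t) (X : ℕ) :
    squareClassAverage S (fun t ↦ if t ∈ G then f t else 0) X ≤
      (∑ t ∈ hG.toFinset, f t) /
        (Nat.card {t : SquareClass K | t ∈ S ∧ squareClassHeight t < X} : ℝ) := by
  unfold squareClassAverage
  have hA : {t : SquareClass K | t ∈ S ∧ squareClassHeight t < X}.Finite :=
    (finite_setOf_squareClassHeight_lt X).subset fun t ht ↦ ht.2
  refine div_le_div_of_nonneg_right ?_ (Nat.cast_nonneg _)
  rw [finsum_mem_eq_finite_toFinset_sum _ hA, ← Finset.sum_filter]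
  refine Finset.sum_le_sum_of_subset_of_nonneg (fun t ht ↦ ?_) fun t _ _ ↦ hf t
  rw [Finset.mem_filter] at ht
  exact hG.mem_toFinset.mpr ht.2

/-- **Finitely many classes do not affect an average bound over an infinite family**: if `Σ` is
infinite, `0 ≤ f`, `0 ≤ g` on `Σ`, `f ≤ g` on `Σ` off a finite set `G`, and the average of `g` over
`Σ` is at most `B`, then so is the average of `f` (the contribution of `G` is `≤ (∑_G f)/|Σ(X)| → 0`).
This is how "for all but finitely many twists" pointwise inputs (Mazur–Rubin 2010, L.5.5) enter the
average-rank bound of BKLOS Thm. 2.4. [cite: BhargavaKlagsbrunLemkeOliverShnidman2019, §9.1 (chunk p0014 L39–L41)]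
[cite: MazurRubin2010, Lemma 5.5] -/
theorem squareClassAverageLe_of_le_off_finite {S G : Set (SquareClass K)} (hS : S.Infinite)
    (hG : G.Finite) {f g : SquareClass K → ℝ} (hf : ∀ t, 0 ≤ f t) (hg0 : ∀ t ∈ S, 0 ≤ g t)
    (hfg : ∀ t ∈ S, t ∉ G → f t ≤ g t) {B : ℝ} (hg : SquareClassAverageLe S g B) :
    SquareClassAverageLe S f B := by
  set F : SquareClass K → ℝ := fun t ↦ if t ∈ G then f t else 0 with hFdef
  set C : ℝ := ∑ t ∈ hG.toFinset, f t with hCdef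
  have hC : 0 ≤ C := Finset.sum_nonneg fun t _ ↦ hf t
  -- pointwise `f ≤ g + F` on `Σ`
  have hpt : ∀ t ∈ S, f t ≤ (1 : ℝ) * g t + 1 * F t := by
    intro t ht
    by_cases htG : t ∈ G
    · simp only [hFdef, htG, if_true, one_mul]; linarith [hg0 t ht]
    · simp only [hFdef, htG, if_false, one_mul, add_zero]; exact hfg t ht htG
  intro ε hε
  -- `C / |Σ(X)| ≤ ε/2` eventually
  have hsmall : ∀ᶠ X : ℕ in atTop,
      C / (Nat.card {t : SquareClass K | t ∈ S ∧ squareClassHeight t < X} : ℝ) ≤ ε / 2 := by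
    have hev := (tendsto_natCard_sep_height_lt_atTop_of_infinite hS).eventually_ge_atTop
      (2 * C / ε + 1)
    filter_upwards [hev] with X hX
    have hpos : (0 : ℝ) < Nat.card {t : SquareClass K | t ∈ S ∧ squareClassHeight t < X} := by
      have : (0 : ℝ) < 2 * C / ε + 1 := by positivity
      linarith
    rw [div_le_iff₀ hpos]
    have h1 : 2 * C / ε * (ε / 2) = C := by field_simp
    nlinarith [h1, hX, hε.le]
  filter_upwards [hg (ε / 2) (by linarith), hsmall] with X hXg hXC
  calc squareClassAverage S f X
      ≤ squareClassAverage S (fun t ↦ (1 : ℝ) * g t + 1 * F t) X := squareClassAverage_mono hpt X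
    _ = squareClassAverage S g X + squareClassAverage S F X := by
        rw [squareClassAverage_linear, one_mul, one_mul]
    _ ≤ (B + ε / 2) + ε / 2 := add_le_add hXg ((squareClassAverage_indicator_le hG hf X).trans hXC)
    _ = B + ε := by ring

end Averages

/-! ## §2 The pointwise bound on `T_m(φ)`: `r₃ ≤ min(#Sel_φ, #Sel_{φ̂}) − 1 + |m|` -/

section Pointwise

open BhargavaKlagsbrunLemkeOliverShnidman2019

/-- **BKLOS §9.1 / BES (8.2), pointwise, every `m`**: for a dual pair of `3`-isogenies `φ : E → E'`,
`φ̂` over a number field with `E(K)[3] = E'(K)[3] = 0`, writing `t = t(φ)`, `#Sel_φ(E) = 3^a`,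
`#Sel_{φ̂}(E') = 3^b`: Cassels' formula with trivial torsion terms gives `a = b + t` EXACTLY, and
Lemma 9.1 gives `r₃(E) ≤ a + b = 2 min(a, b) + |t| ≤ 3^{min(a,b)} − 1 + |t| =
min(#Sel_φ(E), #Sel_{φ̂}(E')) − 1 + |t|` (BES (8.2): `2r + 1 ≤ 3^r`). This is the pointwise form of
"the average rank of `Sel_φ(E_s) ⊕ Sel_{φ̂}(E'_s)` for `s ∈ T_m` is at most `|m| + 3^{−|m|}` … an
upper bound on the rank of `Sel₃(E_s)`" (p0014 L39–L41).
[cite: BhargavaKlagsbrunLemkeOliverShnidman2019, §9.1 (chunk p0014 L35–L41)]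
[cite: BhargavaElkiesShnidman2019, Prop. 42 (i) and display (8.2) (chunk p0017 L12, L29–L35)] -/
theorem natLog_card_selmerGroup_three_le_min_sub_one_add_natAbs_of_facts
    (hC : casselsFormula_selmerRatio) (h91 : lemma91_selmerGroup_exact) {K : Type} [Field K]
    [NumberField K] {W W' : WeierstrassCurve K} [W.IsElliptic] [W'.IsElliptic] (φ : Isogeny W W')
    (ψ : Isogeny W' W) (hφ : φ.degree = 3) (hψ : ψ.degree = 3)
    (hψφ : ∀ P, ψ (φ P) = (3 : ℤ) • P) (hφψ : ∀ Q, φ (ψ Q) = (3 : ℤ) • Q)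
    (hW : Nat.card (AddSubgroup.torsionBy W.toAffine.Point (3 : ℤ)) = 1)
    (hW' : Nat.card (AddSubgroup.torsionBy W'.toAffine.Point (3 : ℤ)) = 1) :
    (Nat.log 3 (Nat.card (W.selmerGroup 3)) : ℝ) ≤
      min (Nat.card φ.selmerGroup : ℝ) (Nat.card ψ.selmerGroup : ℝ) - 1 +
        (logSelmerRatio φ).natAbs := by
  haveI : Fact (Nat.Prime 3) := ⟨Nat.prime_three⟩
  haveI : Finite φ.selmerGroup := finite_selmerGroup_of_lemma91 h91 φ ψ (by norm_num) hψφ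
  haveI : Finite ψ.selmerGroup := finite_selmerGroup_of_lemma91 h91 ψ φ (by norm_num) hφψ
  obtain ⟨a, ha⟩ := φ.exists_natCard_selmerGroup_eq_pow hφ
  obtain ⟨b, hb⟩ := ψ.exists_natCard_selmerGroup_eq_pow hψ
  obtain ⟨r, hr⟩ := exists_natCard_selmerGroup_three_eq_pow W
  -- `r ≤ a + b`
  have hle := natCard_selmerGroup_three_le_of_lemma91 h91 φ ψ hψφ hφψ
  rw [hr, ha, hb, ← pow_add] at hle
  have hrab : r ≤ a + b := (Nat.pow_le_pow_iff_right (by norm_num)).mp hle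
  -- Cassels with trivial torsion terms: `t + b = a`
  have hcφ : φ.ratKerCard = 1 := φ.ratKerCard_eq_one_of_natCard_torsionBy_eq_one ψ hψφ hW
  have hcψ : ψ.ratKerCard = 1 := ψ.ratKerCard_eq_one_of_natCard_torsionBy_eq_one φ hφψ hW'
  obtain ⟨-, -, hE⟩ := hC K W W' φ ψ hφ hψφ
  rw [ha, hb, hcφ, hcψ, selmerRatio_eq_zpow_logSelmerRatio hC φ ψ hφ hψ hψφ] at hE
  push_cast at hE
  simp only [mul_one] at hE
  have h3 : (3 : ℚ) ≠ 0 := by norm_num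
  have hE' : (3 : ℚ) ^ (logSelmerRatio φ + (b : ℤ)) = (3 : ℚ) ^ ((a : ℕ) : ℤ) := by
    rw [zpow_add₀ h3, zpow_natCast, zpow_natCast, hE]
  have hexp : logSelmerRatio φ + (b : ℤ) = (a : ℤ) :=
    zpow_right_injective₀ (by norm_num) (by norm_num) hE'
  -- real-number bookkeeping
  have hlog : (Nat.log 3 (3 ^ r) : ℝ) = r := by rw [Nat.log_pow (by norm_num)]
  rw [hr, hlog, ha, hb]
  simp only [Nat.cast_pow, Nat.cast_ofNat]
  have h2a := two_mul_add_one_le_three_pow_real a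
  have h2b := two_mul_add_one_le_three_pow_real b
  have h13 : (1 : ℝ) ≤ 3 := by norm_num
  have hrr : (r : ℝ) ≤ a + b := by exact_mod_cast hrab
  set t := logSelmerRatio φ with htdef
  set n := t.natAbs with hndef
  rcases le_or_gt 0 t with ht0 | ht0
  · -- `t ≥ 0`: `a = b + t`, `min = 3^b`
    have hnat : (n : ℤ) = t := by rw [hndef]; exact Int.natAbs_of_nonneg ht0
    have hab : a = b + n := by omega
    have hab' : (a : ℝ) = b + n := by exact_mod_cast hab
    have hba : b ≤ a := by omega
    have hmin : min ((3 : ℝ) ^ a) ((3 : ℝ) ^ b) = (3 : ℝ) ^ b :=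
      min_eq_right (pow_le_pow_right₀ h13 hba)
    rw [hmin]
    linarith
  · -- `t < 0`: `b = a + |t|`, `min = 3^a`
    have hnat : (n : ℤ) = -t := by rw [hndef]; exact Int.ofNat_natAbs_of_nonpos ht0.le
    have hab : b = a + n := by omega
    have hab' : (b : ℝ) = a + n := by exact_mod_cast hab
    have hba : a ≤ b := by omega
    have hmin : min ((3 : ℝ) ^ a) ((3 : ℝ) ^ b) = (3 : ℝ) ^ a :=
      min_eq_left (pow_le_pow_right₀ h13 hba)
    rw [hmin]
    linarith

end Pointwise

/-! ## §3 Theorem 2.4 on a signed class `Σ ⊆ T_m(φ)` -/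

namespace BhargavaKlagsbrunLemkeOliverShnidman2019

variable {K : Type} [Field K] [NumberField K] {V V' : WeierstrassCurve K} [V.IsElliptic]
  [V'.IsElliptic] [V.IsCharNeTwoNF] [V'.IsCharNeTwoNF]

/-- **"The average rank of `Sel_φ(E_s) ⊕ Sel_{φ̂}(E'_s)` for `s ∈ T_m` is at most `|m| + 3^{−|m|}` …
an upper bound on the rank of `Sel₃(E_s)`"** (BKLOS §9.1, p0014 L39–L41), in the kernel: granted
Thm. 2.1, Cassels' formula and Lemma 9.1, for a `3`-isogeny dual pair `(φ, φ̂)` over a number field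
(models with `a₁ = a₃ = 0`), `m : ℤ`, and an INFINITE family `Σ` of square classes cut out by
finitely many local conditions and contained in the signed class `T_m(φ) = {s : c(φ_s) = 3^m}`
(sign read at the representative `Quotient.out`): the average over `Σ` (ordered by height) of the
`3`-Selmer rank `log₃ #Sel^{(3)}(E_s/F)` is at most `|m| + 3^{−|m|}`. Proof as printed: Thm. 2.1 for
`φ̂` (`m ≥ 0`: `c(φ̂_s) = 3^{−m}`, "the average size of `Sel_{φ̂}(E'_s)` for `s ∈ T_m` is `1 + 3^{−m}`")
or for `φ` (`m < 0`), the pointwise convexity bound off the Mazur–Rubin torsion classes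
(`natLog_card_selmerGroup_three_le_min_sub_one_add_natAbs_of_facts`), and
`squareClassAverageLe_of_le_off_finite`.
[cite: BhargavaKlagsbrunLemkeOliverShnidman2019, §9.1 (chunk p0014 L33–L41)] -/
theorem squareClassAverageLe_selmerRankThree_signedClass_of_facts
    (h21 : thm21_averageCard_selmerGroup) (hC : casselsFormula_selmerRatio)
    (h91 : lemma91_selmerGroup_exact) (φ : Isogeny V V') (ψ : Isogeny V' V) (hφ : φ.degree = 3)
    (hψ : ψ.degree = 3) (hψφ : ∀ P, ψ (φ P) = (3 : ℤ) • P) (hφψ : ∀ Q, φ (ψ Q) = (3 : ℤ) • Q)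
    (m : ℤ) {S : Set (SquareClass K)}
    (hSm : ∀ t ∈ S, logSelmerRatio (φ.quadraticTwist (Units.ne_zero (Quotient.out t : Kˣ))) = m)
    (hS : S.Infinite) (hloc : IsDefinedByFinitelyManyLocalConditions S) :
    SquareClassAverageLe S (fun t ↦ (Nat.log 3 (Nat.card
      ((V.quadraticTwist ((Quotient.out t : Kˣ) : K)).selmerGroup 3)) : ℝ))
      ((m.natAbs : ℝ) + (3 : ℝ)⁻¹ ^ m.natAbs) := by
  haveI : Fact (Nat.Prime 3) := ⟨Nat.prime_three⟩
  have hne : S.Nonempty := hS.nonempty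
  -- twisted data at the representative of a class
  have hdeg : ∀ t : SquareClass K,
      (φ.quadraticTwist (Units.ne_zero (Quotient.out t : Kˣ))).degree = 3 ∧
        (ψ.quadraticTwist (Units.ne_zero (Quotient.out t : Kˣ))).degree = 3 := fun t ↦
    ⟨by rw [Isogeny.degree_quadraticTwist, hφ], by rw [Isogeny.degree_quadraticTwist, hψ]⟩
  -- the bounding function `g = #Sel − 1 + |m|`, with `#Sel` that of `φ̂` (m ≥ 0) or `φ` (m < 0)
  set χcard : SquareClass K → ℝ :=
    if 0 ≤ m then twistSelmerCard ψ else twistSelmerCard φ with hχ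
  set g : SquareClass K → ℝ := fun t ↦ χcard t - 1 + (m.natAbs : ℝ) with hgdef
  -- (i) Thm 2.1: the averages of `χcard` over `S` tend to `1 + 3^{−|m|}`
  have hχavg : Tendsto (squareClassAverage S χcard) atTop (𝓝 (1 + (3 : ℝ)⁻¹ ^ m.natAbs)) := by
    by_cases hm : 0 ≤ m
    · -- use `φ̂`: `c(φ̂_s) = 3^{−m}` on `S`
      have hconst : ∀ t ∈ S, twistSelmerRatio ψ t = (3 : ℝ)⁻¹ ^ m.natAbs := by
        intro t ht
        have hs := Units.ne_zero (Quotient.out t : Kˣ)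
        haveI := V.isElliptic_quadraticTwist hs
        haveI := V'.isElliptic_quadraticTwist hs
        have hneg := logSelmerRatio_dual_eq_neg hC (φ.quadraticTwist hs) (ψ.quadraticTwist hs)
          (hdeg t).1 (hdeg t).2 (Isogeny.quadraticTwist_comp_quadraticTwist φ ψ hψφ hs)
          (Isogeny.quadraticTwist_comp_quadraticTwist ψ φ hφψ hs)
        have hc := selmerRatio_eq_zpow_logSelmerRatio hC (ψ.quadraticTwist hs)
          (φ.quadraticTwist hs) (hdeg t).2 (hdeg t).1
          (Isogeny.quadraticTwist_comp_quadraticTwist ψ φ hφψ hs)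
        have hm' : m = (m.natAbs : ℤ) := (Int.natAbs_of_nonneg hm).symm
        rw [twistSelmerRatio, hc, hneg, hSm t ht]
        generalize m.natAbs = n at hm'
        subst hm'
        simp only [zpow_neg, zpow_natCast, Rat.cast_inv, Rat.cast_pow, Rat.cast_ofNat, inv_pow]
      have h := h21 K V' V ψ hψ S hne hloc _ (tendsto_squareClassAverage_of_eq_const hne hconst)
      simp only [hχ, hm, if_true]
      exact h
    · -- use `φ`: `c(φ_s) = 3^{m} = 3^{−|m|}` on `S`
      have hconst : ∀ t ∈ S, twistSelmerRatio φ t = (3 : ℝ)⁻¹ ^ m.natAbs := by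
        intro t ht
        have hs := Units.ne_zero (Quotient.out t : Kˣ)
        haveI := V.isElliptic_quadraticTwist hs
        haveI := V'.isElliptic_quadraticTwist hs
        have hc := selmerRatio_eq_zpow_logSelmerRatio hC (φ.quadraticTwist hs)
          (ψ.quadraticTwist hs) (hdeg t).1 (hdeg t).2
          (Isogeny.quadraticTwist_comp_quadraticTwist φ ψ hψφ hs)
        have hm' : m = -(m.natAbs : ℤ) := by
          rw [Int.ofNat_natAbs_of_nonpos (le_of_lt (not_le.mp hm))]; ring
        rw [twistSelmerRatio, hc, hSm t ht]
        generalize m.natAbs = n at hm'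
        subst hm'
        simp only [zpow_neg, zpow_natCast, Rat.cast_inv, Rat.cast_pow, Rat.cast_ofNat, inv_pow]
      have h := h21 K V V' φ hφ S hne hloc _ (tendsto_squareClassAverage_of_eq_const hne hconst)
      simp only [hχ, hm, if_false]
      exact h
  -- (ii) hence the average of `g` over `S` is eventually `≤ |m| + 3^{−|m|} + ε`
  have hg : SquareClassAverageLe S g ((m.natAbs : ℝ) + (3 : ℝ)⁻¹ ^ m.natAbs) := by
    intro ε hε
    have hev := (tendsto_order.1 hχavg).2 (1 + (3 : ℝ)⁻¹ ^ m.natAbs + ε) (by linarith)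
    filter_upwards [hev, eventually_nonempty_sep_height_lt hne] with X hX hXne
    have hlin : squareClassAverage S g X =
        1 * squareClassAverage S χcard X + 1 * squareClassAverage S (fun _ ↦ (-1 + (m.natAbs : ℝ))) X := by
      rw [← squareClassAverage_linear]
      congr 1
      ext t
      simp only [hgdef]; ring
    rw [hlin, squareClassAverage_const _ hXne, one_mul, one_mul]
    linarith
  -- (iii) `g ≥ 0` on `S` and the pointwise bound off the torsion classes
  have hg0 : ∀ t ∈ S, 0 ≤ g t := by
    intro t _
    have hs := Units.ne_zero (Quotient.out t : Kˣ)
    haveI := V.isElliptic_quadraticTwist hs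
    haveI := V'.isElliptic_quadraticTwist hs
    haveI : Finite (ψ.quadraticTwist hs).selmerGroup :=
      finite_selmerGroup_of_lemma91 h91 _ (φ.quadraticTwist hs) (by norm_num)
        (Isogeny.quadraticTwist_comp_quadraticTwist ψ φ hφψ hs)
    haveI : Finite (φ.quadraticTwist hs).selmerGroup :=
      finite_selmerGroup_of_lemma91 h91 _ (ψ.quadraticTwist hs) (by norm_num)
        (Isogeny.quadraticTwist_comp_quadraticTwist φ ψ hψφ hs)
    haveI : Nonempty (ψ.quadraticTwist hs).selmerGroup := ⟨0⟩
    haveI : Nonempty (φ.quadraticTwist hs).selmerGroup := ⟨0⟩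
    have h1ψ : (1 : ℝ) ≤ twistSelmerCard ψ t :=
      Nat.one_le_cast.mpr (Nat.card_pos (α := (ψ.quadraticTwist hs).selmerGroup))
    have h1φ : (1 : ℝ) ≤ twistSelmerCard φ t :=
      Nat.one_le_cast.mpr (Nat.card_pos (α := (φ.quadraticTwist hs).selmerGroup))
    have h1 : (1 : ℝ) ≤ χcard t := by
      simp only [hχ]; split_ifs <;> assumption
    have h0 : (0 : ℝ) ≤ (m.natAbs : ℝ) := Nat.cast_nonneg _
    simp only [hgdef]; linarith
  have hF := (finite_setOf_twistClass_natCard_torsionBy_ne_one V (p := 3) (by decide)).union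
    (finite_setOf_twistClass_natCard_torsionBy_ne_one V' (p := 3) (by decide))
  refine squareClassAverageLe_of_le_off_finite hS hF (fun t ↦ Nat.cast_nonneg _) hg0
    (fun t ht htF ↦ ?_) hg
  simp only [Set.mem_union, Set.mem_setOf_eq, not_or, not_exists, not_and, not_not] at htF
  have hs := Units.ne_zero (Quotient.out t : Kˣ)
  haveI := V.isElliptic_quadraticTwist hs
  haveI := V'.isElliptic_quadraticTwist hs
  have hmin := natLog_card_selmerGroup_three_le_min_sub_one_add_natAbs_of_facts hC h91
    (φ.quadraticTwist hs) (ψ.quadraticTwist hs) (hdeg t).1 (hdeg t).2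
    (Isogeny.quadraticTwist_comp_quadraticTwist φ ψ hψφ hs)
    (Isogeny.quadraticTwist_comp_quadraticTwist ψ φ hφψ hs)
    (htF.1 (Quotient.out t) (QuotientGroup.out_eq' t))
    (htF.2 (Quotient.out t) (QuotientGroup.out_eq' t))
  rw [hSm t ht] at hmin
  have hminle : min (Nat.card (φ.quadraticTwist hs).selmerGroup : ℝ)
      (Nat.card (ψ.quadraticTwist hs).selmerGroup : ℝ) ≤ χcard t := by
    simp only [hχ]
    split_ifs
    · exact min_le_right _ _
    · exact min_le_left _ _
  simp only [hgdef]
  linarith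

/-- **BKLOS Theorem 2.4 for `Σ ⊆ T_m(φ)`, derived in the kernel** ("Since this rank is an upper bound
on the rank of `Sel₃(E_s)`, which is itself an upper bound on the rank of `E_s(F)`, the theorem
follows for any `Σ` contained in `T_m`", p0014 L40–L41): granted Thm. 2.1, Cassels' formula and
Lemma 9.1, for a `3`-isogeny dual pair `(φ, φ̂)` over a number field (models with `a₁ = a₃ = 0`),
`m : ℤ` and an infinite `Σ ⊆ T_m(φ)` cut out by finitely many local conditions, "the average rank of
`E_s(F)`, `s ∈ Σ`, is at most" `|m| + 3^{−|m|}` — the conclusion of the binder `thm24_averageRank_le`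
on `Σ`, where its `rankBoundSummand φ` is identically `|m| + 3^{−|m|}`
(`rankBoundSummand_eq_of_signedClass`). The "general case" (`Σ = ⋃_m Σ ∩ T_m` weighted by densities)
is not replayed (framework claims (F1)/(F2), `OPEN-QUESTIONS-08.md` §K BKLOS-Q6).
[cite: BhargavaKlagsbrunLemkeOliverShnidman2019, Thm. 2.4 (chunk p0005 L1–L2) with §9.1 (chunk p0014 L33–L41)] -/
theorem squareClassAverageLe_rank_signedClass_of_facts
    (h21 : thm21_averageCard_selmerGroup) (hC : casselsFormula_selmerRatio)
    (h91 : lemma91_selmerGroup_exact) (φ : Isogeny V V') (ψ : Isogeny V' V) (hφ : φ.degree = 3)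
    (hψ : ψ.degree = 3) (hψφ : ∀ P, ψ (φ P) = (3 : ℤ) • P) (hφψ : ∀ Q, φ (ψ Q) = (3 : ℤ) • Q)
    (m : ℤ) {S : Set (SquareClass K)}
    (hSm : ∀ t ∈ S, logSelmerRatio (φ.quadraticTwist (Units.ne_zero (Quotient.out t : Kˣ))) = m)
    (hS : S.Infinite) (hloc : IsDefinedByFinitelyManyLocalConditions S) :
    SquareClassAverageLe S (fun t ↦ (twistMordellWeilRank V t : ℝ))
      ((m.natAbs : ℝ) + (3 : ℝ)⁻¹ ^ m.natAbs) :=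
  SquareClassAverageLe.mono
    (fun t _ ↦ by exact_mod_cast twistMordellWeilRank_le_natLog_card_selmerGroup_three V t)
    (squareClassAverageLe_selmerRankThree_signedClass_of_facts h21 hC h91 φ ψ hφ hψ hψφ hφψ m hSm
      hS hloc)

omit [V.IsElliptic] [V'.IsElliptic] in
/-- On a signed class `Σ ⊆ T_m(φ)` the summand `|t(φ_s)| + 3^{−|t(φ_s)|}` of Theorem 2.4
(`rankBoundSummand`, read at the representative) is the constant `|m| + 3^{−|m|}` — so the
hypothesis "the finite averages of `rankBoundSummand φ` over `Σ(X)` tend to `a`" of the binder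
`thm24_averageRank_le` holds with `a = |m| + 3^{−|m|}` (`tendsto_squareClassAverage_of_eq_const`).
[cite: BhargavaKlagsbrunLemkeOliverShnidman2019, Thm. 2.4 (chunk p0005 L1–L2)] -/
theorem rankBoundSummand_eq_of_signedClass (φ : Isogeny V V') (m : ℤ) {S : Set (SquareClass K)}
    (hSm : ∀ t ∈ S, logSelmerRatio (φ.quadraticTwist (Units.ne_zero (Quotient.out t : Kˣ))) = m)
    {t : SquareClass K} (ht : t ∈ S) :
    rankBoundSummand φ t = (m.natAbs : ℝ) + (3 : ℝ)⁻¹ ^ m.natAbs := by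
  simp only [rankBoundSummand, hSm t ht]

end BhargavaKlagsbrunLemkeOliverShnidman2019

end Literature.NumberTheory.EllipticCurves
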